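import Literature.Geometry.Lorentzian.BlackHoles
import HarnessLib

/-!
# Killing-mode stability of a stationary asymptotically flat black hole

This file defines, for the hypothesis structure `StationaryAFBlackHole` of `Stationary.lean`
(a `4`-dimensional spacetime with a stationary Killing field `T = 𝓑.killing`, an asymptotically
flat slice end, derived d.o.c. `𝓑.doc` and future event horizon `𝓑.horizon`), the predicate

* `StationaryAFBlackHole.IsKillingModeStable 𝓑` — **mode stability** of the scalar wave equation
  `□_g ψ = 0` on the domain of outer communications: there is no non-trivial *exponentially growing
  Killing-mode pair*, i.e. no pair of real functions `(ψ, χ)` which is smooth on an open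
  neighbourhood of `d.o.c. ∪ 𝓗⁺`, solves `□_g ψ = □_g χ = 0` on the d.o.c., is an eigenpair of the
  stationary Killing field with eigenvalue `ν + iω`, `ν > 0`,
  `Tψ = νψ − ωχ`, `Tχ = ωψ + νχ` (the real and imaginary parts of `T Ψ = (ν + iω) Ψ` for
  `Ψ = ψ + iχ`, so that along the flow `Ψ ∘ φ_t = e^{(ν + iω) t} Ψ` grows like `e^{νt}`), and is
  bounded on the part `d.o.c. ∩ I⁻(embed (Σ_ext'))` of the d.o.c. in the chronological past of the
  embedded far slice region `Σ_ext' = e.far (e.R + 1)`, other than `ψ = χ = 0` on the d.o.c.;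

together with the bundled hypothesis predicate `StationaryAFBlackHole.IsKillingModePair 𝓑 ν ω ψ χ`
(the four conditions above) and the unfolding / negation lemmas relating the two.

## Source of the notion and faithfulness

On a subextremal Kerr exterior a *mode solution* of `□_g ψ = 0` is a separated solution
`ψ = e^{-iωt} e^{imφ} S(θ) R(r)`, `ω ∈ ℂ ∖ {0}`, whose boundary conditions at `r = r₊` and
`r = ∞` "are uniquely determined by requiring that `ψ` extends smoothly to the horizon [and] has
finite energy along `{t = 0}` when `Im ω > 0`" (Shlapentokh-Rothman, AHP 16 (2015), Def. 1.1 and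
the paragraph following it); "ruling out the exponentially growing mode solutions corresponding to
`Im ω > 0` is the content of *mode stability (in the upper half plane)*. This was established by
Whiting in 1989" (ibid. §1.3; Thm. 1.5: "there exist no non-trivial mode solutions corresponding
to `Im ω > 0`"; Whiting, J. Math. Phys. 30 (1989) 1301). For a general stationary black hole,
Warnick (CMP 333 (2015), §1.4–1.5) characterises mode frequencies `s` by the existence of a
solution "smooth up to [the horizon] of the form `e^{st} w(s, ·)`" in a *regular* slicing, i.e. an
eigenfunction of the stationary Killing field regular across `𝓗⁺` — regularity at the future
horizon replacing the ingoing boundary condition.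

The predicate below is the coordinate-free rendering of "no exponentially growing mode, regular at
`𝓗⁺`, outgoing at infinity" requested (and inlined verbatim in its items `KerrOrBomb`,
`ErgoregionBomb`) by the route `Summits/FinalStateConjecture/…/Theses/ZeroEnergyKerrOrBomb`:
* *growth* is the Killing eigen-equation with `ν = Re s > 0` (frequency `s = ν + iω`), stated
  with `mfderiv` along `T`; no separation in `(θ, φ)` is assumed (a general stationary hole has no
  Carter constant), so on Kerr the class contains all finite sums of separated modes of a fixed
  frequency;
* *regularity at `𝓗⁺`* is smoothness on an open set containing `𝓑.doc ∪ 𝓑.horizon` (Warnick's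
  convention; Shlapentokh-Rothman's "extends smoothly to the horizon");
* the *outgoing / finite-energy condition at infinity* is replaced by **boundedness on
  `𝓑.doc ∩ I⁻(𝓑.embed '' 𝓑.e.far (𝓑.e.R + 1))`**: for `Re s > 0` the radial equation has, at
  infinity, one branch decaying and one growing exponentially in `r` (Shlapentokh-Rothman, CMP 329
  (2014), §3: "all solutions are either exponentially growing or exponentially decaying at
  infinity"); the outgoing branch `e^{s(t − r*)}/r` is bounded on the past of a fixed
  asymptotically flat slice region while the incoming branch `e^{s(t + r*)}/r` is not, and at the
  horizon the regular branch `e^{sv}` is bounded there as well. That this class coincides on Kerr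
  with Def. 1.1 of Shlapentokh-Rothman 2015 is **not** claimed here (it is the route's support item
  `KerrModeStability`); the definition is the route's, recorded by name so that its layer-2 items
  can be stated without repeating it.

Nothing is asserted: both declarations are predicates on the datum `𝓑` (in the manner of
`StationaryAFBlackHole.IsAnalytic`), written with the explicit binder `(𝓑)`.

## Main statements

* `isKillingModeStable_iff` — the verbatim curried expansion (the hypothesis of `KerrOrBomb`);
* `isKillingModeStable_iff_forall_isKillingModePair` — the bundled form;
* `not_isKillingModeStable_iff` — `¬ IsKillingModeStable 𝓑` is the existence of a non-trivial
  growing Killing-mode pair, in the verbatim shape of the conclusion of `ErgoregionBomb`;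
* `isKillingModePair_zero` — the zero pair is a Killing-mode pair of every frequency (constants
  solve the wave equation, `PseudoRiemannianMetric.dalembertian_const`), so the hypothesis class of
  `IsKillingModeStable` is never empty and its conclusion is attained.

## References

* B. F. Whiting, *Mode stability of the Kerr black hole*, J. Math. Phys. 30 (1989) 1301–1305.
  [Whiting1989]
* Y. Shlapentokh-Rothman, *Quantitative mode stability for the wave equation on the Kerr
  spacetime*, Ann. Henri Poincaré 16 (2015) 289–345, arXiv:1302.6902, Def. 1.1, §1.3, Thm. 1.5–1.6.
  [ShlapentokhRothman2015ModeStability]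
* Y. Shlapentokh-Rothman, *Exponentially growing finite energy solutions for the Klein–Gordon
  equation on sub-extremal Kerr spacetimes*, CMP 329 (2014), arXiv:1302.3448, §1.3, §2–3.
* C. M. Warnick, *On quasinormal modes of asymptotically anti-de Sitter black holes*, CMP 333
  (2015) 959–1035, arXiv:1306.5760, §1.4–1.5. [Warnick2013]
-/

noncomputable section

open Set Manifold
open scoped Topology Manifold

universe u

namespace Literature.Geometry.Lorentzian

namespace StationaryAFBlackHole

/-- `(ψ, χ)` is a **Killing-mode pair of frequency `ν + iω`** of the scalar wave equation on the
stationary black hole `𝓑`, regular at the future event horizon and bounded towards the past of the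
far slice region: (i) `ψ, χ` are `C^∞` on some open set containing `𝓑.doc ∪ 𝓑.horizon`;
(ii) `□_g ψ = □_g χ = 0` on the d.o.c.; (iii) on the d.o.c. they form an eigenpair of the
stationary Killing field `T = 𝓑.killing` with eigenvalue `ν + iω`: `dψ(T) = νψ − ωχ`,
`dχ(T) = ωψ + νχ` (real and imaginary parts of `TΨ = (ν + iω)Ψ`, `Ψ = ψ + iχ`, the infinitesimal
form of `Ψ ∘ φ_t = e^{(ν + iω)t} Ψ`); (iv) `|ψ|, |χ| ≤ C` on `𝓑.doc ∩ I⁻(𝓑.embed '' Σ_ext')`,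
`Σ_ext' = 𝓑.e.far (𝓑.e.R + 1)`. For `ν > 0` this is the route `ZeroEnergyKerrOrBomb`'s
coordinate-free form of an *exponentially growing mode solution, smooth across the horizon and
outgoing at infinity* (Shlapentokh-Rothman, AHP 16 (2015), Def. 1.1 and §1.3, on Kerr; Warnick,
CMP 333 (2015), §1.4–1.5, regularity convention at `𝓗⁺`); see the module docstring for what is and
is not claimed about the comparison. [cite: ShlapentokhRothman2015ModeStability, Def. 1.1 and §1.3] -/
def IsKillingModePair (𝓑 : StationaryAFBlackHole.{u}) [𝓑.metric.HasLeviCivita] (ν ω : ℝ)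
    (ψ χ : 𝓑.carrier → ℝ) : Prop :=
  (∃ U : Set 𝓑.carrier, IsOpen U ∧ 𝓑.doc ∪ 𝓑.horizon ⊆ U ∧
      ContMDiffOn (𝓡 4) 𝓘(ℝ, ℝ) ((⊤ : ℕ∞) : WithTop ℕ∞) ψ U ∧
        ContMDiffOn (𝓡 4) 𝓘(ℝ, ℝ) ((⊤ : ℕ∞) : WithTop ℕ∞) χ U) ∧
    (∀ x ∈ 𝓑.doc, 𝓑.metric.dalembertian ψ x = 0 ∧ 𝓑.metric.dalembertian χ x = 0) ∧
    (∀ x ∈ 𝓑.doc, mfderiv (𝓡 4) 𝓘(ℝ, ℝ) ψ x (𝓑.killing x) = ν * ψ x - ω * χ x ∧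
      mfderiv (𝓡 4) 𝓘(ℝ, ℝ) χ x (𝓑.killing x) = ω * ψ x + ν * χ x) ∧
    ∃ C : ℝ, ∀ x ∈ 𝓑.doc ∩ 𝓑.metric.chronologicalPast 𝓑.timeOrientation
      (𝓑.embed '' 𝓑.e.far (𝓑.e.R + 1)), |ψ x| ≤ C ∧ |χ x| ≤ C

/-- The stationary black hole `𝓑` is **Killing-mode stable** (mode stability of `□_g` in the upper
half plane): every Killing-mode pair `(ψ, χ)` of frequency `ν + iω` with **`ν > 0`** — smooth on
an open neighbourhood of `𝓑.doc ∪ 𝓑.horizon`, solving `□_g ψ = □_g χ = 0` on the d.o.c., with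
`dψ(T) = νψ − ωχ`, `dχ(T) = ωψ + νχ` on the d.o.c. and bounded on
`𝓑.doc ∩ I⁻(𝓑.embed '' 𝓑.e.far (𝓑.e.R + 1))` — vanishes identically on the d.o.c. Stated in the
curried form inlined verbatim in the items `KerrOrBomb` / `ErgoregionBomb` of the route
`ZeroEnergyKerrOrBomb` (so that `isKillingModeStable_iff` is `Iff.rfl` there); the bundled form is
`isKillingModeStable_iff_forall_isKillingModePair`. On subextremal Kerr, for separated modes, this
is Whiting's mode stability theorem (Whiting 1989; Shlapentokh-Rothman, AHP 16 (2015), §1.3 and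
Thm. 1.5: "there exist no non-trivial mode solutions corresponding to `Im ω > 0`"). A predicate on
`𝓑`, not a named fact: nothing is asserted. [cite: ShlapentokhRothman2015ModeStability, §1.3 and Thm. 1.5] -/
def IsKillingModeStable (𝓑 : StationaryAFBlackHole.{u}) [𝓑.metric.HasLeviCivita] : Prop :=
  ∀ (ν ω : ℝ) (ψ χ : 𝓑.carrier → ℝ), 0 < ν →
    (∃ U : Set 𝓑.carrier, IsOpen U ∧ 𝓑.doc ∪ 𝓑.horizon ⊆ U ∧
      ContMDiffOn (𝓡 4) 𝓘(ℝ, ℝ) ((⊤ : ℕ∞) : WithTop ℕ∞) ψ U ∧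
        ContMDiffOn (𝓡 4) 𝓘(ℝ, ℝ) ((⊤ : ℕ∞) : WithTop ℕ∞) χ U) →
    (∀ x ∈ 𝓑.doc, 𝓑.metric.dalembertian ψ x = 0 ∧ 𝓑.metric.dalembertian χ x = 0) →
    (∀ x ∈ 𝓑.doc, mfderiv (𝓡 4) 𝓘(ℝ, ℝ) ψ x (𝓑.killing x) = ν * ψ x - ω * χ x ∧
      mfderiv (𝓡 4) 𝓘(ℝ, ℝ) χ x (𝓑.killing x) = ω * ψ x + ν * χ x) →
    (∃ C : ℝ, ∀ x ∈ 𝓑.doc ∩ 𝓑.metric.chronologicalPast 𝓑.timeOrientation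
      (𝓑.embed '' 𝓑.e.far (𝓑.e.R + 1)), |ψ x| ≤ C ∧ |χ x| ≤ C) →
    ∀ x ∈ 𝓑.doc, ψ x = 0 ∧ χ x = 0

variable (𝓑 : StationaryAFBlackHole.{u}) [𝓑.metric.HasLeviCivita]

/-- Unfolding lemma for `IsKillingModeStable`: the verbatim curried form (the mode-stability
hypothesis of the route item `KerrOrBomb`). [folklore] -/
lemma isKillingModeStable_iff : 𝓑.IsKillingModeStable ↔
    ∀ (ν ω : ℝ) (ψ χ : 𝓑.carrier → ℝ), 0 < ν →
      (∃ U : Set 𝓑.carrier, IsOpen U ∧ 𝓑.doc ∪ 𝓑.horizon ⊆ U ∧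
        ContMDiffOn (𝓡 4) 𝓘(ℝ, ℝ) ((⊤ : ℕ∞) : WithTop ℕ∞) ψ U ∧
        ContMDiffOn (𝓡 4) 𝓘(ℝ, ℝ) ((⊤ : ℕ∞) : WithTop ℕ∞) χ U) →
      (∀ x ∈ 𝓑.doc, 𝓑.metric.dalembertian ψ x = 0 ∧ 𝓑.metric.dalembertian χ x = 0) →
      (∀ x ∈ 𝓑.doc, mfderiv (𝓡 4) 𝓘(ℝ, ℝ) ψ x (𝓑.killing x) = ν * ψ x - ω * χ x ∧
        mfderiv (𝓡 4) 𝓘(ℝ, ℝ) χ x (𝓑.killing x) = ω * ψ x + ν * χ x) →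
      (∃ C : ℝ, ∀ x ∈ 𝓑.doc ∩ 𝓑.metric.chronologicalPast 𝓑.timeOrientation
        (𝓑.embed '' 𝓑.e.far (𝓑.e.R + 1)), |ψ x| ≤ C ∧ |χ x| ≤ C) →
      ∀ x ∈ 𝓑.doc, ψ x = 0 ∧ χ x = 0 :=
  Iff.rfl

/-- Unfolding lemma for `IsKillingModePair`. [folklore] -/
lemma isKillingModePair_iff (ν ω : ℝ) (ψ χ : 𝓑.carrier → ℝ) : 𝓑.IsKillingModePair ν ω ψ χ ↔
    (∃ U : Set 𝓑.carrier, IsOpen U ∧ 𝓑.doc ∪ 𝓑.horizon ⊆ U ∧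
        ContMDiffOn (𝓡 4) 𝓘(ℝ, ℝ) ((⊤ : ℕ∞) : WithTop ℕ∞) ψ U ∧
        ContMDiffOn (𝓡 4) 𝓘(ℝ, ℝ) ((⊤ : ℕ∞) : WithTop ℕ∞) χ U) ∧
      (∀ x ∈ 𝓑.doc, 𝓑.metric.dalembertian ψ x = 0 ∧ 𝓑.metric.dalembertian χ x = 0) ∧
      (∀ x ∈ 𝓑.doc, mfderiv (𝓡 4) 𝓘(ℝ, ℝ) ψ x (𝓑.killing x) = ν * ψ x - ω * χ x ∧
        mfderiv (𝓡 4) 𝓘(ℝ, ℝ) χ x (𝓑.killing x) = ω * ψ x + ν * χ x) ∧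
      ∃ C : ℝ, ∀ x ∈ 𝓑.doc ∩ 𝓑.metric.chronologicalPast 𝓑.timeOrientation
        (𝓑.embed '' 𝓑.e.far (𝓑.e.R + 1)), |ψ x| ≤ C ∧ |χ x| ≤ C :=
  Iff.rfl

/-- **Bundled form of mode stability**: `𝓑` is Killing-mode stable iff every Killing-mode pair of
frequency `ν + iω` with `ν > 0` vanishes on the d.o.c. [folklore] -/
lemma isKillingModeStable_iff_forall_isKillingModePair : 𝓑.IsKillingModeStable ↔
    ∀ (ν ω : ℝ) (ψ χ : 𝓑.carrier → ℝ), 0 < ν → 𝓑.IsKillingModePair ν ω ψ χ →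
      ∀ x ∈ 𝓑.doc, ψ x = 0 ∧ χ x = 0 := by
  refine ⟨fun h ν ω ψ χ hν hp ↦ h ν ω ψ χ hν hp.1 hp.2.1 hp.2.2.1 hp.2.2.2,
    fun h ν ω ψ χ hν h₁ h₂ h₃ h₄ ↦ h ν ω ψ χ hν ⟨h₁, h₂, h₃, h₄⟩⟩

variable {𝓑} in
/-- A Killing-mode stable hole has no non-trivial growing Killing-mode pair (application form).
[folklore] -/
lemma IsKillingModeStable.eq_zero (h : 𝓑.IsKillingModeStable) {ν ω : ℝ} {ψ χ : 𝓑.carrier → ℝ}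
    (hν : 0 < ν) (hp : 𝓑.IsKillingModePair ν ω ψ χ) {x : 𝓑.carrier} (hx : x ∈ 𝓑.doc) :
    ψ x = 0 ∧ χ x = 0 :=
  (𝓑.isKillingModeStable_iff_forall_isKillingModePair.1 h) ν ω ψ χ hν hp x hx

/-- **Mode instability, bundled**: `𝓑` is *not* Killing-mode stable iff it carries a Killing-mode
pair of some frequency `ν + iω`, `ν > 0`, which does not vanish identically on the d.o.c.
[folklore] -/
lemma not_isKillingModeStable_iff_exists_isKillingModePair : ¬ 𝓑.IsKillingModeStable ↔
    ∃ (ν ω : ℝ) (ψ χ : 𝓑.carrier → ℝ), 0 < ν ∧ 𝓑.IsKillingModePair ν ω ψ χ ∧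
      ∃ x ∈ 𝓑.doc, ψ x ≠ 0 ∨ χ x ≠ 0 := by
  rw [isKillingModeStable_iff_forall_isKillingModePair]
  constructor
  · intro h
    by_contra hne
    refine h fun ν ω ψ χ hν hp x hx ↦ ?_
    by_contra hx0
    exact hne ⟨ν, ω, ψ, χ, hν, hp, x, hx, not_and_or.1 hx0⟩
  · rintro ⟨ν, ω, ψ, χ, hν, hp, x, hx, hx0⟩ h
    obtain ⟨h₁, h₂⟩ := h ν ω ψ χ hν hp x hx
    exact hx0.elim (fun h' ↦ h' h₁) (fun h' ↦ h' h₂)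

/-- **Mode instability, verbatim**: `𝓑` is *not* Killing-mode stable iff there are `ν > 0`, `ω`
and a pair `(ψ, χ)`, smooth on an open neighbourhood of `𝓑.doc ∪ 𝓑.horizon`, solving the wave
equation and the Killing eigen-equations of frequency `ν + iω` on the d.o.c., bounded on
`𝓑.doc ∩ I⁻(𝓑.embed '' 𝓑.e.far (𝓑.e.R + 1))`, and not identically zero on the d.o.c. — the
shape of the conclusion of the route item `ErgoregionBomb` ("the hole is a black-hole bomb").
[folklore] -/
lemma not_isKillingModeStable_iff : ¬ 𝓑.IsKillingModeStable ↔
    ∃ (ν ω : ℝ) (ψ χ : 𝓑.carrier → ℝ), 0 < ν ∧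
      (∃ U : Set 𝓑.carrier, IsOpen U ∧ 𝓑.doc ∪ 𝓑.horizon ⊆ U ∧
        ContMDiffOn (𝓡 4) 𝓘(ℝ, ℝ) ((⊤ : ℕ∞) : WithTop ℕ∞) ψ U ∧
        ContMDiffOn (𝓡 4) 𝓘(ℝ, ℝ) ((⊤ : ℕ∞) : WithTop ℕ∞) χ U) ∧
      (∀ x ∈ 𝓑.doc, 𝓑.metric.dalembertian ψ x = 0 ∧ 𝓑.metric.dalembertian χ x = 0) ∧
      (∀ x ∈ 𝓑.doc, mfderiv (𝓡 4) 𝓘(ℝ, ℝ) ψ x (𝓑.killing x) = ν * ψ x - ω * χ x ∧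
        mfderiv (𝓡 4) 𝓘(ℝ, ℝ) χ x (𝓑.killing x) = ω * ψ x + ν * χ x) ∧
      (∃ C : ℝ, ∀ x ∈ 𝓑.doc ∩ 𝓑.metric.chronologicalPast 𝓑.timeOrientation
        (𝓑.embed '' 𝓑.e.far (𝓑.e.R + 1)), |ψ x| ≤ C ∧ |χ x| ≤ C) ∧
      ∃ x ∈ 𝓑.doc, ψ x ≠ 0 ∨ χ x ≠ 0 := by
  rw [not_isKillingModeStable_iff_exists_isKillingModePair]
  simp only [isKillingModePair_iff, and_assoc]

variable {𝓑} in
/-- A hole carrying a non-trivial growing Killing-mode pair is not Killing-mode stable (the form in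
which `ErgoregionBomb` feeds `KerrOrBomb`). [folklore] -/
lemma not_isKillingModeStable_of_isKillingModePair {ν ω : ℝ} {ψ χ : 𝓑.carrier → ℝ} (hν : 0 < ν)
    (hp : 𝓑.IsKillingModePair ν ω ψ χ) {x : 𝓑.carrier} (hx : x ∈ 𝓑.doc)
    (hx0 : ψ x ≠ 0 ∨ χ x ≠ 0) : ¬ 𝓑.IsKillingModeStable :=
  𝓑.not_isKillingModeStable_iff_exists_isKillingModePair.2 ⟨ν, ω, ψ, χ, hν, hp, x, hx, hx0⟩

/-- **The zero pair is a Killing-mode pair of every frequency** (constants are smooth and solve the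
wave equation, `PseudoRiemannianMetric.dalembertian_const`; `d0 = 0`): the hypothesis class of
`IsKillingModeStable` is never empty, and its conclusion `ψ = χ = 0` on the d.o.c. is attained.
[folklore] -/
lemma isKillingModePair_zero (ν ω : ℝ) : 𝓑.IsKillingModePair ν ω (fun _ ↦ 0) (fun _ ↦ 0) := by
  refine ⟨⟨univ, isOpen_univ, subset_univ _, contMDiffOn_const, contMDiffOn_const⟩,
    fun x _ ↦ ⟨?_, ?_⟩, fun x _ ↦ ?_, ⟨0, fun x _ ↦ by simp⟩⟩
  · exact PseudoRiemannianMetric.dalembertian_const _ 0 x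
  · exact PseudoRiemannianMetric.dalembertian_const _ 0 x
  · have h0 : mfderiv (𝓡 4) 𝓘(ℝ, ℝ) (fun _ : 𝓑.carrier ↦ (0 : ℝ)) x = 0 := mfderiv_const
    refine ⟨?_, ?_⟩ <;>
      simp only [h0, zero_apply, mul_zero, sub_self, add_zero] <;> rfl

end StationaryAFBlackHole

end Literature.Geometry.Lorentzian

end
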